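import Mathlib
import HarnessLib
import Summits.HubbardSuperconductivity.HubbardSuperconductivity.Theorems.KLProgrammeKLRegimeSplitFrameEnergyGap
import Summits.HubbardSuperconductivity.HubbardSuperconductivity.Theorems.KLProgrammeKLRegimeVolumeLimitCauchyTermwise

/-!
# Route `KLProgramme` — crux K3, child «VolumeLimit» (gen 4: stmt-HubbardSuperconductivity-19858 `KLRegimeVolumeLimitV12`):
# the CROSS-VOLUME torus moduli of an admissible frame's band and propagator symbol — the `D`-constants of
# `stub_vl_twoVolumeRate` for the lowest-order terms (cell gate-hubbard-kl, seat hubbard-kl-k3c4-p1 g3, technique «volume lemmas»)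

WHY.  The registered stub `…Theorems.KLRegimeVolumeLimit.stub_vl_twoVolumeRate` of the VL skeleton «cauchy» compares the two-leg vertex
function at two volumes through the modulus `D·Σ_i |p_k i − p′_{k′} i|_𝕋` between torus momenta of DIFFERENT grids `(ℤ/L)²`, `(ℤ/L′)²`; the
summation device `twoVolumeRate_of_termwise` (`…VolumeLimitCauchyTermwise`) asks it of every term, and
`norm_sub_le_mul_tmod_of_periodic` (ibid.) reduces it to a sup-metric Lipschitz constant of a `2π`-periodic integrand.  This module records
the two constants every term of the expansion is built from, for EVERY admissible frame (`FrameOK R U N μ K`, whose clause (i) is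
`GeomConstants (frameLevel μ K) 7 …`: `‖De_K‖ ≤ 7` everywhere — p1 g7's `…SplitFrameEnergyGap`, which treats ONE volume, `k` vs `k − Q`):

* `klvf_norm_toLp_two_le` — `‖p‖₂ ≤ √2·‖p‖_∞` on `Fin 2 → ℝ`;
* `klvf_abs_frameLevel_sub_le_tmod` — `|e_K(p) − e_K(q)| ≤ 7√2 · Σ_i |p_i − q_i|_𝕋` for all `p q : Fin 2 → ℝ` (periodicity + mean value);
* **`klvf_abs_nambuXiCT_sub_le_of_frameOK`** — ACROSS VOLUMES: `|nambuXiCT L μ K k − nambuXiCT L′ μ K k′| ≤ 7√2 · Σ_i |p_k i − p′_{k′} i|_𝕋`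
  for all `L, L′ ≥ 1`, `k ∈ (ℤ/L)²`, `k′ ∈ (ℤ/L′)²`;
* `klvf_norm_inv_sub_inv_le` — `‖(a − iω)⁻¹ − (b − iω)⁻¹‖ ≤ |a − b|/ω²` (`ω ≠ 0`), and **`klvf_norm_framePropSymbol_sub_le_of_frameOK`** —
  the frame propagator symbol `(e_K(p_k) − i ω)⁻¹` at equal Matsubara integers, two volumes: `≤ (β/π)²·7√2·Σ_i |p_k i − p′_{k′} i|_𝕋`.

Everything PROVED; no definition, no named fact; nothing is asserted about the model.
-/

noncomputable section

namespace Summit.HubbardSuperconductivity.HubbardSuperconductivity.Theorems.KLRegimeSplit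

set_option linter.dupNamespace false -- summit = problem name (single-conjunct summit), D-0017

open Real Finset Literature.MathematicalPhysics.QuantumLattice Literature.Probability.LatticeModels
open Literature.MathematicalPhysics.QuantumLattice.FermiRG
open Summit.HubbardSuperconductivity.HubbardSuperconductivity.Theorems.DispersionFlow
open Summit.HubbardSuperconductivity.HubbardSuperconductivity.Theorems.KLProgrammeLegKernels

/-! ## §1 The frame band on `ℝ²` against the torus modulus -/

/-- `‖p‖₂ ≤ √2 · ‖p‖_∞` for `p : Fin 2 → ℝ` read in `EuclideanSpace ℝ (Fin 2)`. [folklore] -/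
theorem klvf_norm_toLp_two_le (v : Fin 2 → ℝ) : ‖(WithLp.toLp 2 v : Momentum)‖ ≤ Real.sqrt 2 * ‖v‖ := by
  have hsq : ‖(WithLp.toLp 2 v : Momentum)‖ ^ 2 ≤ (Real.sqrt 2 * ‖v‖) ^ 2 := by
    rw [EuclideanSpace.norm_sq_eq, mul_pow, Real.sq_sqrt (by norm_num : (0 : ℝ) ≤ 2)]
    calc ∑ i, ‖(WithLp.toLp 2 v : Momentum) i‖ ^ 2 ≤ ∑ _i : Fin 2, ‖v‖ ^ 2 := Finset.sum_le_sum fun i _ => by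
            have h := norm_le_pi_norm v i
            have h0 : 0 ≤ ‖v i‖ := norm_nonneg _
            simpa using pow_le_pow_left₀ h0 h 2
      _ = 2 * ‖v‖ ^ 2 := by simp [Finset.sum_const, Finset.card_univ, Fintype.card_fin]
  exact (pow_le_pow_iff_left₀ (norm_nonneg _) (by positivity) two_ne_zero).1 hsq

/-- **`|e_K(p) − e_K(q)| ≤ 7√2 · Σ_i |p_i − q_i|_𝕋`** for the band of a frame with `GeomConstants (frameLevel μ K) 7 (3/80) (1/2) (3/200)`
(clause (i) of `FrameOK`), all `p q : Fin 2 → ℝ`: `(2πℤ)²`-periodicity + the mean-value bound `7‖·‖₂` + `‖·‖₂ ≤ √2‖·‖_∞`. [folklore] -/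
theorem klvf_abs_frameLevel_sub_le_tmod {μ : ℝ} {K : TrigPolyC4v}
    (hG : GeomConstants (frameLevel μ K) 7 (3 / 80) (1 / 2) (3 / 200)) (p q : Fin 2 → ℝ) :
    |frameLevel μ K (WithLp.toLp 2 p) - frameLevel μ K (WithLp.toLp 2 q)| ≤ 7 * Real.sqrt 2 * ∑ i, torusAbs (p i - q i) := by
  have h := norm_sub_le_mul_tmod_of_periodic (E := ℝ) (f := fun u : Fin 2 → ℝ => frameLevel μ K (WithLp.toLp 2 u))
    (K := 7 * Real.sqrt 2) (by positivity) (fun u z => kled_frameLevel_periodic μ K u z) ?_ p q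
  · simpa [Real.norm_eq_abs] using h
  · intro u w
    rw [Real.norm_eq_abs]
    calc |frameLevel μ K (WithLp.toLp 2 u) - frameLevel μ K (WithLp.toLp 2 w)|
        ≤ 7 * ‖(WithLp.toLp 2 u : Momentum) - WithLp.toLp 2 w‖ := kled_abs_frameLevel_sub_le hG _ _
      _ = 7 * ‖(WithLp.toLp 2 (u - w) : Momentum)‖ := by rw [WithLp.toLp_sub]
      _ ≤ 7 * (Real.sqrt 2 * ‖u - w‖) := by gcongr; exact klvf_norm_toLp_two_le _
      _ = 7 * Real.sqrt 2 * ‖u - w‖ := by ring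

/-! ## §2 Across volumes: the frame band at torus momenta of two grids -/

/-- **The frame band across volumes**: for an admissible frame and torus momenta `k ∈ (ℤ/L)²`, `k′ ∈ (ℤ/L′)²` of two (possibly different)
grids, `|nambuXiCT L μ K k − nambuXiCT L′ μ K k′| ≤ 7√2 · Σ_i |p_k i − p′_{k′} i|_𝕋`. [folklore] -/
theorem klvf_abs_nambuXiCT_sub_le_of_frameOK {L L' : ℕ} [NeZero L] [NeZero L'] {R : RenConsts} {U : ℝ} {N : ℕ} {μ : ℝ}
    {K : TrigPolyC4v} (hK : FrameOK R U N μ K) (k : TorusSite 2 L) (k' : TorusSite 2 L') :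
    |nambuXiCT L μ K k - nambuXiCT L' μ K k'| ≤
      7 * Real.sqrt 2 * ∑ i, torusAbs (latticeMomentum L k i - latticeMomentum L' k' i) := by
  rw [EngineV8.nambuXiCT_eq_frameLevel L μ K k, EngineV8.nambuXiCT_eq_frameLevel L' μ K k']
  exact klvf_abs_frameLevel_sub_le_tmod hK.1 _ _

/-! ## §3 The frame propagator symbol across volumes -/

/-- `‖(a − iω)⁻¹ − (b − iω)⁻¹‖ ≤ |a − b| / ω²` for real `a b` and `ω ≠ 0` (both denominators have modulus `≥ |ω|`). [folklore] -/
theorem klvf_norm_inv_sub_inv_le {ω : ℝ} (hω : ω ≠ 0) (a b : ℝ) :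
    ‖((a : ℂ) - Complex.I * ω)⁻¹ - ((b : ℂ) - Complex.I * ω)⁻¹‖ ≤ |a - b| / ω ^ 2 := by
  have hden : ∀ c : ℝ, |ω| ≤ ‖((c : ℂ) - Complex.I * ω)‖ := fun c => by
    have him : (((c : ℂ) - Complex.I * ω)).im = -ω := by simp
    calc |ω| = |(((c : ℂ) - Complex.I * ω)).im| := by rw [him, abs_neg]
      _ ≤ ‖((c : ℂ) - Complex.I * ω)‖ := Complex.abs_im_le_norm _
  have hne : ∀ c : ℝ, ((c : ℂ) - Complex.I * ω) ≠ 0 := fun c h => by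
    have := hden c; rw [h, norm_zero] at this; exact hω (abs_nonpos_iff.1 this)
  have hω2 : 0 < ω ^ 2 := by positivity
  rw [inv_sub_inv (hne a) (hne b), norm_div, norm_mul]
  have hnum : ‖((b : ℂ) - Complex.I * ω) - ((a : ℂ) - Complex.I * ω)‖ = |a - b| := by
    rw [show ((b : ℂ) - Complex.I * ω) - ((a : ℂ) - Complex.I * ω) = ((b - a : ℝ) : ℂ) by push_cast; ring, Complex.norm_real,
      Real.norm_eq_abs, abs_sub_comm]
  rw [hnum, div_le_div_iff₀ (mul_pos (lt_of_lt_of_le (abs_pos.2 hω) (hden a)) (lt_of_lt_of_le (abs_pos.2 hω) (hden b))) hω2]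
  have hprod : ω ^ 2 ≤ ‖((a : ℂ) - Complex.I * ω)‖ * ‖((b : ℂ) - Complex.I * ω)‖ := by
    rw [← sq_abs, sq]
    exact mul_le_mul (hden a) (hden b) (abs_nonneg _) (norm_nonneg _)
  exact mul_le_mul_of_nonneg_left hprod (abs_nonneg _)

/-- Equal Matsubara integers label the SAME frequency at any two cutoffs. [folklore] -/
theorem klvf_matsubaraFreq_eq_of_matsubaraInt_eq {M M' : ℕ} (β : ℝ) {ω : MatsubaraIdx M} {ω' : MatsubaraIdx M'}
    (h : matsubaraInt M ω = matsubaraInt M' ω') : matsubaraFreq β M ω = matsubaraFreq β M' ω' := by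
  unfold matsubaraFreq; rw [h]

/-- **The frame propagator symbol across volumes**: for an admissible frame, `0 < β`, two cutoffs `M, M′`, frequency labels with the same
Matsubara integer and torus momenta of two grids,
`‖(e_K(p_k) − iω)⁻¹ − (e_K(p′_{k′}) − iω)⁻¹‖ ≤ (β/π)² · 7√2 · Σ_i |p_k i − p′_{k′} i|_𝕋` (`|ω| ≥ π/β`). [folklore] -/
theorem klvf_norm_framePropSymbol_sub_le_of_frameOK {L L' M M' : ℕ} [NeZero L] [NeZero L'] {R : RenConsts} {U : ℝ} {N : ℕ}
    {μ β : ℝ} (hβ : 0 < β) {K : TrigPolyC4v} (hK : FrameOK R U N μ K) {ω : MatsubaraIdx M} {ω' : MatsubaraIdx M'}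
    (hωω' : matsubaraInt M ω = matsubaraInt M' ω') (k : TorusSite 2 L) (k' : TorusSite 2 L') :
    ‖((nambuXiCT L μ K k : ℂ) - Complex.I * matsubaraFreq β M ω)⁻¹ -
        ((nambuXiCT L' μ K k' : ℂ) - Complex.I * matsubaraFreq β M' ω')⁻¹‖ ≤
      (β / Real.pi) ^ 2 * (7 * Real.sqrt 2 * ∑ i, torusAbs (latticeMomentum L k i - latticeMomentum L' k' i)) := by
  rw [← klvf_matsubaraFreq_eq_of_matsubaraInt_eq β hωω']
  set w : ℝ := matsubaraFreq β M ω with hw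
  have hwabs : Real.pi / β ≤ |w| := pi_div_le_abs_matsubaraFreq hβ ω
  have hπβ : 0 < Real.pi / β := div_pos Real.pi_pos hβ
  have hw0 : w ≠ 0 := fun h => by rw [h, abs_zero] at hwabs; linarith
  have h1 := klvf_norm_inv_sub_inv_le hw0 (nambuXiCT L μ K k) (nambuXiCT L' μ K k')
  have h2 := klvf_abs_nambuXiCT_sub_le_of_frameOK hK k k'
  have hw2 : (Real.pi / β) ^ 2 ≤ w ^ 2 := by
    rw [← sq_abs w]; exact pow_le_pow_left₀ hπβ.le hwabs 2
  have hmod0 : 0 ≤ 7 * Real.sqrt 2 * ∑ i, torusAbs (latticeMomentum L k i - latticeMomentum L' k' i) :=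
    mul_nonneg (by positivity) (klvc_tmod_nonneg _ _)
  calc _ ≤ |nambuXiCT L μ K k - nambuXiCT L' μ K k'| / w ^ 2 := h1
    _ ≤ (7 * Real.sqrt 2 * ∑ i, torusAbs (latticeMomentum L k i - latticeMomentum L' k' i)) / w ^ 2 := by
        gcongr
    _ ≤ (7 * Real.sqrt 2 * ∑ i, torusAbs (latticeMomentum L k i - latticeMomentum L' k' i)) / (Real.pi / β) ^ 2 :=
        div_le_div_of_nonneg_left hmod0 (by positivity) hw2
    _ = (β / Real.pi) ^ 2 * (7 * Real.sqrt 2 * ∑ i, torusAbs (latticeMomentum L k i - latticeMomentum L' k' i)) := by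
        have hπ : Real.pi ≠ 0 := Real.pi_pos.ne'
        field_simp

end Summit.HubbardSuperconductivity.HubbardSuperconductivity.Theorems.KLRegimeSplit
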